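import Mathlib
import Summits.CriticalPhenomena.CardyFormulaZ2.Theorems.CardySelfRefinementGradientComparabilityStubNonAxialShareBulkLocal
import Summits.CriticalPhenomena.CardyFormulaZ2.Theorems.CardySelfRefinementGradientComparabilityStubLayerContact
import Literature.Probability.LatticeModels.LocalParafermionicTemplate
import Literature.Probability.Percolation.OrbitLoopDarts
import HarnessLib

/-!
# Boundary-layer surgery, brick (S5), part I: links to the sides near the boundary

Helper file of the registered stub `stub_layerLocalModification` (the deterministic
boundary-layer surgery) of the line `monotone-product-coordinates` (crux
`stmt-CriticalPhenomena-10269`, `…Theses.CardySelfRefinement.GradientComparability`), step (S5)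
(bridge transfer): the link calculus of the closure semantics NEAR the boundary of a quad `Q`,
complementing the bulk toolkit `…StubNonAxialShareBulk{Topology,Reroute}` (whose
`crossing_decomposition` / `endpoint_links` require the new edges to be drawn off
`∂₀Q ∪ ∂₂Q`, resp. inside `[Q]°`):

* `exists_link_of_crossing_union` (registered helper) — **one-sided decomposition**: if `τ`
  does not cross `Q` but `τ ∪ S` does, and the drawing of the new edges `S` avoids the side
  `∂_jQ` (`j ∈ {0, 2}`; it may touch the opposite side), then some lattice end of an edge of
  `S` is linked in `τ` to `∂_jQ` (the crossing path, started on `∂_jQ`, first enters the new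
  drawing at a drawn lattice end);
* `link_sdiff_edge` — a link to `∂_jQ` survives closing one edge `{v, w}` at a vertex `v`
  which is itself not linked to `∂_jQ` (drawn off `∂_jQ`);
* `quad_noRoom_cellContact_rev` — the cell-contact lemma (S4) read from the other end of
  the edge;
* `isPivotal_Aloc_one_of_crossing`, `mem_window_one_of_dist_lt` — the dictionary between
  pivotality for the localised crossing event `Aloc 1 ![Q] η` and raw crossings inside the
  drawn open edges, and window bookkeeping (lattice translations and distances along segments
  come from `LocalParafermionicTemplate.zdGraph_adj_add_right`, `dist_le_of_mem_segment_ends`).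

No percolation, no named fact.
-/

noncomputable section

namespace Summit.CriticalPhenomena.CardyFormulaZ2.Theorems.CardySelfRefinement

open scoped Topology
open Filter Set MeasureTheory
open Literature.Probability.LatticeModels Literature.Probability.Percolation
open Literature.Probability.Percolation.QuadCrossing
open Summit.CriticalPhenomena.CardyFormulaZ2.Theses.CardySelfRefinement

variable {D : Set ℂ} {δ : ℝ}

/-! ## Lattice bookkeeping -/

/-- A genuine lattice edge with an end drawn (at mesh `η√2`) within distance `1` of `[Q]` is a
window edge of the single quad `Q`. -/
theorem mem_window_one_of_dist_lt (Q : Quad (Set.univ : Set ℂ)) {η : ℝ} {a b : Site 2}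
    (hab : (zdGraph 2).Adj a b) {q : ℂ} (hq : q ∈ Q.carrier)
    (hd : dist (meshPoint (η * Real.sqrt 2) a) q < 1) : s(a, b) ∈ window 1 ![Q] η := by
  refine Set.mem_iUnion.2 ⟨0, ⟨a, b, rfl, ⟨meshPoint (η * Real.sqrt 2) a, ?_, ?_⟩⟩,
    (SimpleGraph.mem_edgeSet _).2 hab⟩
  · rw [eta_mul_z_eq_meshPoint, eta_mul_z_eq_meshPoint]
    exact left_mem_segment ℝ _ _
  · simp only [Matrix.cons_val_fin_one]
    exact Metric.mem_thickening_iff.2 ⟨q, hq, hd⟩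

/-! ## Pivotality for `Aloc 1 ![Q] η` from raw crossings -/

/-- **Dictionary.**  If `t` is a window edge, `(κ ∩ window) ∪ {t}` crosses `Q` inside its
drawing at mesh `η√2` and `κ ∩ window` does not, then `t` is pivotal for the localised
crossing event `Aloc 1 ![Q] η` in `κ`. -/
theorem isPivotal_Aloc_one_of_crossing {η : ℝ} (hη : 0 < η) (Q : Quad (Set.univ : Set ℂ))
    {κ : BondConfig (Site 2)} {t : Sym2 (Site 2)} (ht : t ∈ window 1 ![Q] η)
    (hin : ∃ K, Q.IsCrossing K ∧
      K ⊆ openEdgeUnion (η * Real.sqrt 2) (insert t (κ ∩ window 1 ![Q] η)))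
    (hout : ¬ ∃ K, Q.IsCrossing K ∧ K ⊆ openEdgeUnion (η * Real.sqrt 2) (κ ∩ window 1 ![Q] η)) :
    IsPivotal (Aloc 1 ![Q] η) t κ := by
  set W : Set (Sym2 (Site 2)) := window 1 ![Q] η with hW
  have hWE : W ⊆ (zdGraph 2).edgeSet := by
    intro x hx
    simp only [hW, window, edgesNear, Set.mem_iUnion, Set.mem_inter_iff] at hx
    obtain ⟨-, -, hx⟩ := hx
    exact hx
  have hmem : ∀ ω' : BondConfig (Site 2), ω' ∈ Aloc 1 ![Q] η ↔
      ∃ K, Q.IsCrossing K ∧ K ⊆ openEdgeUnion (η * Real.sqrt 2) (ω' ∩ W) := by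
    intro ω'
    change (∀ i, ![Q] i ∈ configOf squareLatticeEmbedding.z η Set.univ (ω' ∩ W)) ↔ _
    simp only [Fin.forall_fin_one, Matrix.cons_val_fin_one]
    exact mem_configOf_iff_exists_isCrossing_openEdgeUnion hη (Set.inter_subset_right.trans hWE) Q
  refine Or.inl ⟨?_, fun h => ?_⟩
  · rw [hmem]
    obtain ⟨K, hK, hKX⟩ := hin
    refine ⟨K, hK, hKX.trans (openEdgeUnion_mono _ ?_)⟩
    rintro x (rfl | ⟨hx, hxW⟩)
    · exact ⟨mem_insert _ _, ht⟩
    · exact ⟨mem_insert_of_mem _ hx, hxW⟩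
  · rw [hmem] at h
    obtain ⟨K, hK, hKX⟩ := h
    exact hout ⟨K, hK, hKX.trans (openEdgeUnion_mono _
      (Set.inter_subset_inter_left _ Set.sdiff_subset))⟩

/-! ## Closing an edge at a vertex not linked to a side keeps the links of other points -/

/-- **Link survival.**  Let `{v, w}` be a lattice edge drawn off `∂_jQ` (inside `[Q]`), `v` NOT
linked in `τ` to `∂_jQ`, and `z₀ ∉ {v, w}` linked in `τ` to `∂_jQ`.  Then `z₀` is still linked
to `∂_jQ` in `τ ∖ {vw}`: a link path of `z₀` meets the segment of `vw` first and last at drawn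
lattice ends, which must both be `w`. -/
theorem link_sdiff_edge (hδ : 0 < δ) (Q : Quad D) {τ : BondConfig (Site 2)} {j : Fin 4}
    {v w z₀ : Site 2} (hvw : (zdGraph 2).Adj v w) (hz₀v : z₀ ≠ v) (hz₀w : z₀ ≠ w)
    (hseg : ∀ z ∈ segment ℝ (meshPoint δ v) (meshPoint δ w), z ∈ Q.carrier → z ∉ Q.side j)
    (hv : ¬ ∃ c ∈ Q.side j, JoinedIn (Q.carrier ∩ openEdgeUnion δ τ) c (meshPoint δ v))
    (hz₀ : ∃ c ∈ Q.side j, JoinedIn (Q.carrier ∩ openEdgeUnion δ τ) c (meshPoint δ z₀)) :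
    ∃ c ∈ Q.side j, JoinedIn (Q.carrier ∩ openEdgeUnion δ (τ \ {s(v, w)})) c (meshPoint δ z₀) := by
  obtain ⟨c, hc, hJ⟩ := hz₀
  set O := openEdgeUnion δ (τ \ {s(v, w)}) with hOdef
  set A := segment ℝ (meshPoint δ v) (meshPoint δ w) with hAdef
  have hOc : IsClosed O := isClosed_openEdgeUnion hδ _
  have hAc : IsClosed A := (isCompact_segment_complex _ _).isClosed
  have hcov : openEdgeUnion δ τ ⊆ O ∪ A := by
    refine (openEdgeUnion_subset_union_of_subset δ (R := {s(v, w)}) (ω' := τ \ {s(v, w)})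
      fun e he => ?_).trans (Set.union_subset_union_right _ (openEdgeUnion_singleton_subset δ v w))
    by_cases h : e = s(v, w)
    · exact Or.inr h
    · exact Or.inl ⟨he, h⟩
  -- common points of the segment and the rest of the drawing are `v` or `w`
  have hOA : ∀ z ∈ A, z ∈ O → z = meshPoint δ v ∨ z = meshPoint δ w := by
    intro z hzA hzO
    have hzA' : z ∈ openEdgeUnion δ ({s(v, w)} : BondConfig (Site 2)) :=
      segment_subset_openEdgeUnion' δ (ω := {s(v, w)}) hvw (mem_singleton _) hzA
    obtain ⟨x, rfl, ⟨y, -, hy⟩, -⟩ := exists_vertex_of_mem_inter hδ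
      (S := {s(v, w)}) (T := τ \ {s(v, w)}) (fun e he heT => heT.2 he) hzA' hzO
    rcases eq_or_eq_of_sym2_eq (mem_singleton_iff.1 hy) with rfl | rfl
    · exact Or.inl rfl
    · exact Or.inr rfl
  set p := hJ.somePath with hp
  set γ : ℝ → ℂ := ⇑p.extend with hγdef
  have hγc : Continuous γ := p.continuous_extend
  have hγmem : ∀ u, γ u ∈ Q.carrier ∧ γ u ∈ O ∪ A := fun u => by
    have h1 : γ u ∈ Set.range p := by rw [← p.extend_range]; exact ⟨u, rfl⟩
    obtain ⟨t, ht⟩ := h1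
    have h2 := hJ.somePath_mem t
    rw [← hp, ht] at h2
    exact ⟨h2.1, hcov h2.2⟩
  have hγ0 : γ 0 = c := p.extend_zero
  have hγ1 : γ 1 = meshPoint δ z₀ := p.extend_one
  have hc0 : γ 0 ∉ A := fun h => hseg _ h (hγ0 ▸ Q.side_subset_carrier j hc) (hγ0 ▸ hc)
  have hz1 : γ 1 ∉ A := fun h => by
    rw [hγ1] at h
    rcases Mesh.eq_or_eq_of_meshPoint_mem_segment hδ hvw h with h' | h'
    · exact hz₀v h'
    · exact hz₀w h'
  by_cases hhit : ∃ u ∈ Icc (0 : ℝ) 1, γ u ∈ A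
  swap
  · push Not at hhit
    refine ⟨c, hc, ?_⟩
    have key := joinedIn_of_arc (F := Q.carrier ∩ O) hγc zero_le_one
      (fun u hu => (⟨(hγmem u).1, (hγmem u).2.resolve_right (hhit u hu)⟩ : γ u ∈ Q.carrier ∩ O))
    rwa [hγ0, hγ1] at key
  obtain ⟨w', hw', hγw'⟩ := hhit
  -- last visit to the segment: at `w`, then inside `O` up to `z₀`
  obtain ⟨s₁, hs₁, hγs₁, hO₁⟩ :=
    exists_last_hit hγc hOc hAc hw'.2 (fun u _ => (hγmem u).2) hγw' hz1
  have hs₁O : γ s₁ ∈ O := hO₁ s₁ (left_mem_Icc.2 hs₁.2.le)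
  have hJ₁ : JoinedIn (Q.carrier ∩ O) (γ s₁) (meshPoint δ z₀) := by
    have := joinedIn_of_arc (F := Q.carrier ∩ O) hγc hs₁.2.le
      (fun u hu => (⟨(hγmem u).1, hO₁ u hu⟩ : γ u ∈ Q.carrier ∩ O))
    rwa [hγ1] at this
  have hw₁ : γ s₁ = meshPoint δ w := by
    rcases hOA _ hγs₁ hs₁O with h | h
    · exact absurd ⟨c, hc, hJ.trans ((h ▸ hJ₁).mono (Set.inter_subset_inter_right _
        (openEdgeUnion_mono δ Set.sdiff_subset))).symm⟩ hv
    · exact h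
  -- first visit to the segment: at `w`, from `c` inside `O`
  obtain ⟨s₀, hs₀, hγs₀, hO₀⟩ :=
    exists_first_hit hγc hOc hAc hw'.1 (fun u _ => (hγmem u).2) hc0 hγw'
  have hs₀O : γ s₀ ∈ O := hO₀ s₀ (right_mem_Icc.2 hs₀.1.le)
  have hJ₀ : JoinedIn (Q.carrier ∩ O) c (γ s₀) := by
    have := joinedIn_of_arc (F := Q.carrier ∩ O) hγc hs₀.1.le
      (fun u hu => (⟨(hγmem u).1, hO₀ u hu⟩ : γ u ∈ Q.carrier ∩ O))
    rwa [hγ0] at this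
  have hw₀ : γ s₀ = meshPoint δ w := by
    rcases hOA _ hγs₀ hs₀O with h | h
    · exact absurd ⟨c, hc, (h ▸ hJ₀).mono (Set.inter_subset_inter_right _
        (openEdgeUnion_mono δ Set.sdiff_subset))⟩ hv
    · exact h
  exact ⟨c, hc, (hw₀ ▸ hJ₀).trans (hw₁ ▸ hJ₁)⟩

/-! ## The cell-contact lemma read from the other end -/

/-- **Cell contact from the far end.**  Under the hypotheses of `quad_noRoom_cellContact` for
the edge `{u, u'}` (which are symmetric in `u`, `u'`), the conclusion also holds with the roles
of `u` and `u'` exchanged: a contact `a ∈ ∂₀Q ∪ ∂₂Q` reached from `u'` along the cell-boundary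
walk `u' → u' + n → u + n → u` inside `[Q]`. -/
theorem quad_noRoom_cellContact_rev (hδ : 0 < δ) (Q : Quad D) {u u' : Site 2}
    (huu' : (zdGraph 2).Adj u u')
    (hseg : segment ℝ (meshPoint δ u) (meshPoint δ u') ⊆ Q.carrier)
    (hopen : openSegment ℝ (meshPoint δ u) (meshPoint δ u') ⊆ interior Q.carrier)
    (hdist : ∀ z ∈ Q.side 1, ∀ w ∈ Q.side 3, 3 * δ ≤ dist z w)
    (hroom : ∀ n : Site 2, (zdGraph 2).Adj u (u + n) → u + n ≠ u' → u - n ≠ u' →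
      ¬ (segment ℝ (meshPoint δ u) (meshPoint δ (u + n)) ∪
          segment ℝ (meshPoint δ (u + n)) (meshPoint δ (u' + n)) ∪
          segment ℝ (meshPoint δ (u' + n)) (meshPoint δ u') ⊆ Q.carrier))
    (hND : ∀ (β : Set ℂ) (a b m : ℂ) (ρ : ℝ), m ∈ openSegment ℝ (meshPoint δ u) (meshPoint δ u') →
      Literature.Topology.PlaneTopology.IsSimpleArc β a b → a ∉ Q.side 0 ∪ Q.side 2 →
      b ∉ Q.side 0 ∪ Q.side 2 → β \ {a, b} ⊆ interior Q.carrier →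
      β ∩ openEdgeUnion δ Set.univ ⊆ {m} → 0 < ρ → Metric.ball m ρ ⊆ interior Q.carrier →
      β ∩ Metric.ball m ρ = Metric.ball m ρ ∩
        {z | inner ℝ (z - m) (meshPoint δ u' - meshPoint δ u) = 0} →
      ¬ (a ∈ Q.side 1 ∧ b ∈ Q.side 1 ∨ a ∈ Q.side 3 ∧ b ∈ Q.side 3)) :
    ∃ n : Site 2, (zdGraph 2).Adj u' (u' + n) ∧ u' + n ≠ u ∧ u' - n ≠ u ∧
      ∃ a ∈ Q.side 0 ∪ Q.side 2,
        (a ∈ segment ℝ (meshPoint δ u') (meshPoint δ (u' + n)) ∧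
          segment ℝ (meshPoint δ u') a ⊆ Q.carrier) ∨
        (a ∈ segment ℝ (meshPoint δ (u' + n)) (meshPoint δ (u + n)) ∧
          segment ℝ (meshPoint δ u') (meshPoint δ (u' + n)) ∪
            segment ℝ (meshPoint δ (u' + n)) a ⊆ Q.carrier) ∨
        (a ∈ segment ℝ (meshPoint δ (u + n)) (meshPoint δ u) ∧
          segment ℝ (meshPoint δ u') (meshPoint δ (u' + n)) ∪
            segment ℝ (meshPoint δ (u' + n)) (meshPoint δ (u + n)) ∪
            segment ℝ (meshPoint δ (u + n)) a ⊆ Q.carrier) := by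
  have hseg' : segment ℝ (meshPoint δ u') (meshPoint δ u) ⊆ Q.carrier := by
    rwa [segment_symm]
  have hopen' : openSegment ℝ (meshPoint δ u') (meshPoint δ u) ⊆ interior Q.carrier := by
    rwa [openSegment_symm]
  refine quad_noRoom_cellContact D δ hδ Q u' u huu'.symm hseg' hopen' hdist
    (fun n hn hne hne' hsub => ?_) (fun β a b m ρ hm hβ ha hb hβQ hβX hρ hball hβball => ?_)
  · have hn' : (zdGraph 2).Adj u (u + n) := by
      have := LocalParafermionicTemplate.zdGraph_adj_add_right hn (u - u')
      convert this using 1 <;> abel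
    refine hroom n hn' (fun h => hne' ?_) (fun h => hne ?_) ?_
    · rw [← h]; abel
    · rw [← h]; abel
    · intro z hz
      apply hsub
      rcases hz with (hz | hz) | hz
      · refine Or.inr ?_
        rwa [segment_symm]
      · refine Or.inl (Or.inr ?_)
        rwa [segment_symm]
      · refine Or.inl (Or.inl ?_)
        rwa [segment_symm]
  · have hm' : m ∈ openSegment ℝ (meshPoint δ u) (meshPoint δ u') := by
      rwa [openSegment_symm]
    refine hND β a b m ρ hm' hβ ha hb hβQ hβX hρ hball ?_
    rw [hβball]
    congr 1
    ext z
    simp only [mem_setOf_eq]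
    rw [← neg_sub (meshPoint δ u') (meshPoint δ u), inner_neg_right, neg_eq_zero]

/-! ## One-sided decomposition of a crossing through new edges -/

/-- **One-sided decomposition** (registered helper).  Let `τ` be a configuration not crossing
`Q` and `S` a set of further edges, not in `τ`, whose drawing avoids the side `∂_jQ`
(`j = 0` or `j = 2`; it may touch the opposite side).  If `τ ∪ S` crosses `Q` (path form), then
some lattice end `v` of an edge of `S` is linked in `τ` to `∂_jQ`: the crossing path started on
`∂_jQ` runs inside the drawing of `τ` until it first enters the drawing of `S`, which it can do
only at a drawn lattice end. -/
theorem exists_link_of_crossing_union : ∀ (D : Set ℂ) (δ : ℝ), 0 < δ → ∀ (Q : Quad D) (τ S : BondConfig (Site 2)) (j : Fin 4), (j = 0 ∨ j = 2) → (∀ e ∈ S, e ∉ τ) → (∀ z ∈ openEdgeUnion δ S, z ∉ Q.side j) → (¬ ∃ a ∈ Q.side 0, ∃ b ∈ Q.side 2, JoinedIn (Q.carrier ∩ openEdgeUnion δ τ) a b) → (∃ a ∈ Q.side 0, ∃ b ∈ Q.side 2, JoinedIn (Q.carrier ∩ openEdgeUnion δ (τ ∪ S)) a b) → ∃ v : Site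 2, (∃ y, (zdGraph 2).Adj v y ∧ s(v, y) ∈ S) ∧ ∃ c ∈ Q.side j, JoinedIn (Q.carrier ∩ openEdgeUnion δ τ) c (meshPoint δ v) := by
  intro D δ hδ Q τ S j hj hτS hS hτ hcr
  have h22 : (2 : Fin 4) + 2 = 0 := by decide
  -- a path from `∂_jQ` to the opposite side
  obtain ⟨c, hc, c', hc', hJ⟩ : ∃ c ∈ Q.side j, ∃ c' ∈ Q.side (j + 2),
      JoinedIn (Q.carrier ∩ openEdgeUnion δ (τ ∪ S)) c c' := by
    obtain ⟨a, ha, b, hb, hJ⟩ := hcr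
    rcases hj with rfl | rfl
    · exact ⟨a, ha, b, hb, hJ⟩
    · exact ⟨b, hb, a, by rw [h22]; exact ha, hJ.symm⟩
  set p := hJ.somePath with hp
  set γ : ℝ → ℂ := ⇑p.extend with hγdef
  have hγc : Continuous γ := p.continuous_extend
  set O := openEdgeUnion δ τ with hOdef
  set A := openEdgeUnion δ S with hAdef
  have hOc : IsClosed O := isClosed_openEdgeUnion hδ τ
  have hAc : IsClosed A := isClosed_openEdgeUnion hδ S
  have hγmem : ∀ u, γ u ∈ Q.carrier ∧ γ u ∈ O ∪ A := fun u => by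
    have h1 : γ u ∈ Set.range p := by rw [← p.extend_range]; exact ⟨u, rfl⟩
    obtain ⟨t, ht⟩ := h1
    have h2 := hJ.somePath_mem t
    rw [← hp, ht, openEdgeUnion_union] at h2
    exact h2
  have hγ0 : γ 0 = c := p.extend_zero
  have hγ1 : γ 1 = c' := p.extend_one
  have hc0 : γ 0 ∉ A := fun h => hS _ h (hγ0 ▸ hc)
  by_cases hhit : ∃ u ∈ Icc (0 : ℝ) 1, γ u ∈ A
  · obtain ⟨w, hw, hγw⟩ := hhit
    obtain ⟨s₀, hs₀, hγs₀, hO₀⟩ :=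
      exists_first_hit hγc hOc hAc hw.1 (fun u _ => (hγmem u).2) hc0 hγw
    have hs₀O : γ s₀ ∈ O := hO₀ s₀ (right_mem_Icc.2 hs₀.1.le)
    obtain ⟨v, hv, hvS, -⟩ := exists_vertex_of_mem_inter hδ hτS hγs₀ hs₀O
    refine ⟨v, hvS, c, hc, ?_⟩
    have := joinedIn_of_arc (F := Q.carrier ∩ O) hγc hs₀.1.le
      (fun u hu => (⟨(hγmem u).1, hO₀ u hu⟩ : γ u ∈ Q.carrier ∩ O))
    rwa [hγ0, hv] at this
  · exfalso
    push Not at hhit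
    refine hτ ?_
    have key := joinedIn_of_arc (F := Q.carrier ∩ O) hγc zero_le_one
      (fun u hu => (⟨(hγmem u).1, (hγmem u).2.resolve_right (hhit u hu)⟩ : γ u ∈ Q.carrier ∩ O))
    rw [hγ0, hγ1] at key
    rcases hj with rfl | rfl
    · exact ⟨c, hc, c', hc', key⟩
    · exact ⟨c', by rw [← h22]; exact hc', c, hc, key.symm⟩

end Summit.CriticalPhenomena.CardyFormulaZ2.Theorems.CardySelfRefinement

end
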